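import Summits.BirchSwinnertonDyer.Rank1Residual.F1Sign2.DescentSignAtTwo
import Literature.NumberTheory.EllipticCurves.MazurTateElementOddPairProofs
import HarnessLib

/-!
# Cell `bsd-f1-sign2` — analytic / Waldspurger–Gross–Zagier lens (seat `-an`) g4: **AN-10, the descent sign
# read by the Gross–Zagier packet `L(E/ℚ(i), s) = L(E, s)·L(E^{(−1)}, s)`**

STATEMENTS ONLY (defs with bodies, nothing asserted; no `sorry`). Source memo: `HOME/MEMO-an.md` v1.6 §2 AN-10.

`-data`'s D9 §6 law (3 801 good-at-2, `Δ > 0`, odd-torsion curves, `N < 2·10⁴`): on the supersingular,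
rank-1, `N ≡ 1 (mod 4)` stratum, `ε(E) = −1 ⇒ 4 ∣ x⁻(1/4)` (158/158), where `x⁻(1/4) = −L(E^{(−1)},1)/|ω₂(E)|`
is PARI's odd modular symbol at `1/4` (tree units: `[1/4]⁻_f = −x⁻(1/4)/2`, `L♭₋(0) = −2[1/4]⁻_f`) and
`ε(E) ∈ {±1}` is the real-place descent sign of seat `-desc` (MEMO-desc §10; on this stratum `ε = +1` iff the
generator meets the egg, tree `MeetsEgg`).

The analytic lens's reading (this file): `x⁻(1/4)` is the central value of the TWIST BY `−1`, i.e. the second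
factor of the Gross–Zagier packet `L(E/K, s) = L(E,s)L(E^{(−1)},s)`, `K = ℚ(i)`; the law is the BSD₂-shadow of
an elementary descent fact over `K`:

* **AN-10K** `DescentSignShaOverImagQuadratic`: `ε(E) = −1` ⇒ `Ш(E/K)[2] ≠ 0` for every imaginary quadratic
  `K = ℚ(√d)` with `rank E^{(d)}(ℚ) = 0` (the relaxed-at-`∞` class `c ∈ S¹(E) ∖ Sel₂(E)` restricts into
  `Sel₂(E/K)` — `∞` becomes complex, finite Kummer conditions are functorial — and is not a Kummer class over `K`
  because `E(K) ⊗ ℤ₂ = E(ℚ) ⊗ ℤ₂`; `res` is injective as `E(K)[2] = 0`). In-print-assembly (Kramer 1981 Thm 1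
  with Prop. 6 `i_∞ = 1`); typed on the D9 stratum (rank 1, `Ш(E)[2] = 0`, where `ε = −1 ⇔ ¬ MeetsEgg`).
* **AN-10P** `DescentSignPacketLawAtTwo` (all ranks; `ε` through `-desc`'s admissible-twist characterisation
  T-A: `ε = −1 ⇔ #Sel₂(E^{(d)}) = 2·#Sel₂(E)` for admissible `d`): `ε(E) = −1`, `rank E^{(−1)} = 0` ⇒
  `2^{r+1} ∣ #Ш(E)·Tam(E)·#Ш(E^{(−1)})·Tam(E^{(−1)})`, `r = rank E(ℚ)` — Cassels–Tate (`#Ш(E/K)[2^∞]` a square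
  `≥ 4`) + isogeny invariance of the BSD quotient for `E × E^{(−1)} → Res_{K/ℚ} E` (Milne ADT I.7.3), whose
  2-adic bookkeeping `v₂(#Ш#Ш'·Tam·Tam') = v₂#Ш(E/K) + v₂Tam(E/K) + (r − 1)` is certified numerically
  (inferred `v₂#Ш(E/ℚ(i)) ∈ 2ℤ_{≥0}` on 746/746 semistable rows; PARI-over-`ℚ(i)` ENGINE C). Census 505/505
  good-at-2 rows with `ε = −1` (+ multiplicative-at-2 rank-1: 131/131).
* **AN-10B** `DescentSignTwistLawAtTwo` (= the D9 law in BSD currency, rank 1): `ε(E) = −1` ⇒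
  `4 ∣ #Ш(E^{(−1)})·Tam(E^{(−1)})`; census 269/269 (ss 92, ord 46, mult 131), hypothesis sharp on ss
  (`ε = +1` ⇒ `v₂ ≤ 1` on 645/722) and mult (627/1 283 at `v₂ = 1`).
* **AN-10Λ** `DescentSignOddFlatAtTwo` (= the D9 law verbatim, symbol / `Λ`-adic; conjecture = AN-10B + BSD₂ of the
  rank-0 twist): `ε(E) = −1` ⇒ `[1/4]⁻_f = 0 ∨ ‖[1/4]⁻_f‖₂ ≤ 2⁻¹`, and for every odd-branch Sprung pair
  `4 ∣ L♭₋(0)` (hence, by the odd functional equation AN-9F, `2 ∣ [T¹]L♭₋` and `λ(L♭₋) ≥ λ_generic + 2`: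
  92/92 at layer 6, converse `λ = λ_generic ⇒ ε = +1` 276/276).

TYPER FILING (seat `bsd-f1-sign2-ty`; CANDIDATES.md rows AN-10K / AN-10Λ / AN-10K⁼): the -an g4 sketches
`HOME/MEMO-an-data/g4/Sketch_v5.lean` c4167c715dfed0a4 and `Sketch_v5b.lean` 9d34e03953be9b90 (rc 0, 0 warnings, 0 sorries),
re-filed VERBATIM for the REF1 §24 SURVIVORS only — `StrictRankOne`, `DescentSignNeg` (helpers), AN-10K
`DescentSignShaOverImagQuadratic` (24.1: theorem-grade descent, in-print-assembly Kramer 1981 Thm 1 + Prop 6), AN-10Λ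
`DescentSignOddFlatAtTwo` (24.4: good at 2 built in; odd-pair binder non-vacuous by p549522), AN-10K⁼
`DescentSignIffShaOverAdmissibleField` (24.5); the three decls REF1 §24 KILLED AS TYPED (AN-10P, AN-10B, AN-10B′ — T19
additive-at-2 scope, witness 196b1) are OMITTED. STATEMENTS ONLY; nothing asserted, no named fact, PARTITION: none moved.
REF2 placement per MEMO-an v1.7 §4 / REF2 v9–v10 (AN-10K in-print-assembly; beyond-print theorem: no).

LANDING NOTE (-ty g14, 2026-08-29T03:5xZ; text only, statements untouched): **AN-10K `DescentSignShaOverImagQuadratic` IS NOW A TREE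
THEOREM, finiteness-free** — `Summit.BirchSwinnertonDyer.BirchSwinnertonDyer.Theorems.GenusKolyArch.descentSignShaOverImagQuadratic_holds :
DescentSignShaOverImagQuadratic` (gk2-p5 g17, p689829 ACCEPTED, file
`Summits/BirchSwinnertonDyer/BirchSwinnertonDyer/Theorems/GenusKolyvaginAtTwoGenusPrimitiveSupplyAtTwoDescentSignShaOverImagQuadratic.lean` §200–§202,
`--supports stmt-BirchSwinnertonDyer-22136`, std axioms `propext` / `Classical.choice` / `Quot.sound` re-checked by the typer with
`lean check --axioms`): on the D9 habitat (`Δ > 0`, `E(ℚ)[2] = 0`, rank `1`, `Ш(E)[2] = 0`, `¬ MeetsEgg`) for EVERY `d < 0` with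
`rank E^{(d)}(ℚ) = 0` and EVERY quadratic `K ∋ √d`: `∃ c ∈ Ш(E_K/K), c ≠ 0, 2c = 0` — NO finiteness of `Ш`, no parity, no `L`-function
(Kramer 1981 Thm 1 + Prop 6 formalised: the relaxed-at-`∞` class restricts into `Ш(E_K/K)` since `K` is totally complex; if it died it
would be a Kummer class over `K`, and the descent step `exists_sub_incl_eq_two_smul` + `mordellWeilRank_baseChange_eq_add_of_sq_eq` +
injectivity of `resTorsion` bring it back to `Sel₂(E/ℚ)`, contradicting `[Sel₂^{rel ∞} : Sel₂] = 2`). Consumers: feed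
`(h : DescentSignShaOverImagQuadratic)` with `descentSignShaOverImagQuadratic_holds`. AN-10K⁼ `DescentSignIffShaOverAdmissibleField`: «⇒»
is now one `exact` (DescAdmissible ⟹ `d < 0`); «⇐» (`ε = +1 ⟹ Ш(E/K)[2] = 0`) is NOT a tree theorem — gk2-p5 flags that as typed it may
need finiteness of `Ш(E/K)[2^∞]` or Kramer's Thm 2 norm pairing; REF1 §164 / §164-add (2026-08-29T02:35Z–02:36Z) give a Cassels–Tate-free
route («cor Sel₂(E/K) ⊆ Sel₂(E^{(d)}/ℚ) = 0»); no statement change here. CANDIDATES.md row AN-10K marked «TREE THEOREM». Bib hygiene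
(REF2 v45 §17, text only): the interim stub key `MTT1986` below now reads `MazurTateTeitelbaum1986Invent` (same paper, Invent. Math. 84).
PARTITION: none; beyond-print theorem: no (Kramer 1981 Thm 1 / Prop 6 formalised finiteness-free); BSD not proved; no item closed.
LANDING NOTE 2 (-ty g15, 2026-08-29T04:4xZ; text only, statements untouched): **AN-10K⁼ `DescentSignIffShaOverAdmissibleField` IS NOW A
TREE THEOREM, finiteness-free, BOTH directions** —
`Summit.BirchSwinnertonDyer.BirchSwinnertonDyer.Theorems.GenusKolyArch.descentSignIffShaOverAdmissibleField_holds : DescentSignIffShaOverAdmissibleField`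
(gk2-p5 g17, **p693908 ACCEPTED**, file `Summits/BirchSwinnertonDyer/BirchSwinnertonDyer/Theorems/GenusKolyvaginAtTwoGenusPrimitiveSupplyAtTwoDescentSignIffSha.lean`
= file 50 of the SUPPLY lineage, 15 theorems, `--supports stmt-BirchSwinnertonDyer-22136`; std axioms `propext` / `Classical.choice` /
`Quot.sound` re-checked by the typer with `lean check --axioms`; REF1 §171 (04:02Z): «REF1 §164 verdict → SETTLED»).  «⇒» = LANDING NOTE 1
(file 47); «⇐» = `GenusKolyArch.sha_two_eq_zero_of_meetsEgg_of_descAdmissible` (`ε = +1 ⟹ Ш(E_K/K)[2] = 0`: lift `c` to `m ∈ Sel₂(E_K)`;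
`y := cor m` has `res_K y = m + σ₀m`, `loc_∞ y = 0` (file 48), `y ∈ Sel₂^{rel∞}(E)` (file 49) `= Sel₂(E)` (`ε = +1`, file 29), whose only class
trivial at `∞` is `0` (`#Sel₂(E) = 2` + the egg class non-trivial at `∞`, file 22) ⟹ `σ₀m = m` ⟹ `m = res x₁` (gk2-p3
`mem_range_resTorsion_iff_conjAct_eq`) with `x₁ ∈ Sel₂(E)` ⟹ `c = res[x₁] = 0` as `Ш(E)[2] = 0`) — NO finiteness, no parity, no `L`-function
(the Cassels–Tate-free route REF1 §164 / §164-add asked for).  Structural by-products in the same file (usable BY NAME):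
`resTorsion_mem_selmerGroup_iff_mem_selmerGroupRelaxedAtInfinityAtTwo` (`res_K⁻¹ Sel₂(E_K/K) = Sel₂^{rel∞}(W)`),
`mem_selmerGroup_and_conjAct_eq_iff_exists_mem_relaxed` (Kramer Thm 1's invariant part, any `σ₀ ≠ 1`), `mordellWeilRank_baseChange_eq_one`,
`natCard_selmerGroup_baseChange_two_eq_two_mul` (`#Sel₂(E_K) = 2·#Ш(E_K)[2]`), `natCard_selmerGroup_baseChange_two_eq_two_iff_meetsEgg`
(`#Sel₂(E_K/K) = 2 ⟺ ε = +1` on the locus — -an: AN-31's hypothesis «`#Sel₂(E/K) = 2`» IS the descent sign on the DescAdmissible locus), and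
DESC-28-G `trivialShaDoorFieldSelmerCardAtTwo_holds` (landing note on `F1Sign2/DoorFieldAtTwo.lean`).  Consumers: feed
`(h : DescentSignIffShaOverAdmissibleField)` with `GenusKolyArch.descentSignIffShaOverAdmissibleField_holds`.  CANDIDATES.md row AN-10K⁼ marked
«TREE THEOREM (p693908)» (pass 120).  PARTITION none; beyond-print theorem: no (Kramer 1981 in-print assembly, kernel-checked); BSD not proved. -/

namespace Summit.BirchSwinnertonDyer.Rank1Residual.F1Sign2

open scoped Classical MatrixGroups ModularForm
open CongruenceSubgroup WeierstrassCurve Literature.NumberTheory.EllipticCurves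
open Literature.NumberTheory.EllipticCurves.ModularForms
open Literature.NumberTheory.EllipticCurves.Rank1Residual
open Literature.NumberTheory.EllipticCurves.Sprung2017

set_option autoImplicit false

noncomputable section

/-- The D9 habitat predicate: `Δ > 0`, `E(ℚ)[2] = 0`, rank one, `Ш(E)[2] = 0`, and descent sign `ε(E) = −1`
(no rational point on the egg: the generator lies on the identity real component). -/
def StrictRankOne (W : WeierstrassCurve ℚ) [W.IsGloballyMinimal] : Prop :=
  0 < W.Δ ∧ NoRationalTwoTorsion W ∧ W.mordellWeilRank = 1 ∧ ShaTwoTrivial W ∧ ¬ MeetsEgg W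

/-- **AN-10K `DescentSignShaOverImagQuadratic` (descent theorem-candidate, in-print-assembly: Kramer 1981,
Thm 1 + Prop. 6).** On the D9 habitat, for every imaginary quadratic field `K = ℚ(√d)` (`d < 0`) such that the
twist `E^{(d)}` has rank `0`: `Ш(E/K)` has a non-zero `2`-torsion class (the restriction of the relaxed-at-`∞`
Selmer class). D9 case: `d = −1`, `K = ℚ(i)`. [cite: Kramer1981, Thm. 1, Prop. 6] -/
def DescentSignShaOverImagQuadratic : Prop :=
  ∀ (W : WeierstrassCurve ℚ) [W.IsElliptic] [W.IsGloballyMinimal], StrictRankOne W →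
    ∀ d : ℤ, d < 0 → (W.quadraticTwist (d : ℚ)).mordellWeilRank = 0 →
      ∀ (K : Type) [Field K] [NumberField K], Module.finrank ℚ K = 2 → (∃ i : K, i ^ 2 = (d : K)) →
        ∃ c ∈ (W.baseChange K).sha, c ≠ 0 ∧ 2 • c = 0

/-- `ε(W) = −1` for a general `W` (`Δ > 0`, `E(ℚ)[2] = 0`), through `-desc`'s THEOREM A (tree T-A/T-A′
`AdmissibleTwistSelmerShiftAtTwo` / `…LevelAtTwo`): some (equivalently every) descent-admissible twist DOUBLES
`#Sel₂`. On the rank-1, `Ш[2] = 0` stratum this is `¬ MeetsEgg` (tree T-C `EggTwistLawAtTwo`). -/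
def DescentSignNeg (W : WeierstrassCurve ℚ) [W.IsGloballyMinimal] : Prop :=
  ∃ d : ℤ, DescAdmissible W d ∧ twistSelmerTwoCard W d = 2 * selmerTwoCard W

/-! AN-10P `DescentSignPacketLawAtTwo` and AN-10B `DescentSignTwistLawAtTwo` of the sketch are NOT filed: REF1-AUDIT §24
KILLED AS TYPED (refuted-misstated, trap T19 ADDITIVE-AT-2 SCOPE — witness 196b1); a repaired C′ with the reduction
hypothesis at 2 awaits the planner. -/

/-- **AN-10Λ `DescentSignOddFlatAtTwo` (the D9 law verbatim: symbol level; conjecture = AN-10B + the 2-part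
of BSD for the rank-0 twist `E^{(−1)}`).** `W` good at `2`, on the D9 habitat, `f` its newform: the `χ₋₄`-twisted
central minus symbol `[1/4]⁻_f` (`= −x⁻(1/4)/2 = −L♭₋(0)/2`) is `0` (iff `L(E^{(−1)},1) = 0`) or has
`‖[1/4]⁻_f‖₂ ≤ 2⁻¹`; equivalently `4 ∣ L♭₋(0)` for every odd-branch Sprung pair `(L♯₋, L♭₋)`.
Census (D9-RESULT-v1, ENGINE D2 symbols): 158/158 (66 zeros + 92 with `v₂(x⁻) ≥ 2`); `Λ`-adic corollary
(odd functional equation): `λ(L♭₋) ≥ λ_generic + 2` on 92/92, `λ = λ_generic ⇒ ε = +1` on 276/276.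
[cite: Sprung2017, Cor. 4.14] [cite: MazurTateTeitelbaum1986Invent, §I.17] -/
def DescentSignOddFlatAtTwo : Prop :=
  ∀ (W : WeierstrassCurve ℚ) [W.IsElliptic] [W.IsGloballyMinimal], StrictRankOne W →
    W.HasGoodReductionAtPrime 2 →
    ∀ ⦃N : ℕ⦄ [NeZero N] (f : CuspForm (Gamma0 N) 2), IsNewformOf W f →
      (ratMinusSymbol f (1 / 4) = 0 ∨ ‖((ratMinusSymbol f (1 / 4) : ℚ) : ℚ_[2])‖ ≤ 2⁻¹) ∧
      ∀ Ls Lf : IwasawaAlgebra 2, IsSprungPairOdd f 2 (W.frobeniusTrace 2) Ls Lf →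
        (4 : ℤ_[2]) ∣ PowerSeries.constantCoeff Lf

end

/-- **AN-10K⁼ `DescentSignIffShaOverAdmissibleField` (theorem-candidate, in-print-assembly: Kramer 1981 Thm 1,
Thm 2, Props 1–6, with Prop 6 read with its sign).** `Δ > 0`, `E(ℚ)[2] = 0`, rank one, `Ш(E)[2] = 0`,
`d` descent-admissible with `rank E^{(d)}(ℚ) = 0`, `K` any quadratic number field containing `√d`:
`E(ℚ)` misses the egg (`ε(E) = −1`) **iff** `Ш(E/K)` has a non-zero `2`-torsion class. (`⇒` is AN-10K on this
locus; `⇐` is `-desc`'s T-C `EggTwistLawAtTwo` in `Ш(E/K)`-form.) Census: `ε = −1`: `4 ∣ #Ш_an(E/ℚ(√−7))`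
on 12/12; `ε = +1`: `#Ш_an(E/K)` odd on 170/170 (`d = −7`: 115, `−15`: 18, `−23`: 37); norm-clean
super-locus (`I_fin = 0`, ten fields): 2 440/2 440. [cite: Kramer1981, Thm. 1, Thm. 2, Prop. 6] -/
def DescentSignIffShaOverAdmissibleField : Prop :=
  ∀ (W : WeierstrassCurve ℚ) [W.IsElliptic] [W.IsGloballyMinimal], 0 < W.Δ → NoRationalTwoTorsion W →
    W.mordellWeilRank = 1 → ShaTwoTrivial W →
    ∀ d : ℤ, DescAdmissible W d → (W.quadraticTwist (d : ℚ)).mordellWeilRank = 0 →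
      ∀ (K : Type) [Field K] [NumberField K], Module.finrank ℚ K = 2 → (∃ i : K, i ^ 2 = (d : K)) →
        (¬ MeetsEgg W ↔ ∃ c ∈ (W.baseChange K).sha, c ≠ 0 ∧ 2 • c = 0)

/-! AN-10B′ `DescentSignOddTwistLawAtTwo` of Sketch_v5b is NOT filed (REF1 §24 KILLED AS TYPED, T19). -/

end Summit.BirchSwinnertonDyer.Rank1Residual.F1Sign2
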